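import Summits.ValiantsHypothesis.ValiantsHypothesis.Theorems.FifoMatchingNNDivisionHardMaxCutLPBridge

/-!
# FifoMatching · NNDivisionHard — MAX-CUT LP classes, part 4/4: §6d–§6f hypothesis-free consequences (`maxCutLPApproxHard_holds`, `maxCutLPHard_holds`, classes K / K_θ / K^aff_θ DECIDED, `AffThin`)

Theorems-grade port (bytes staged by val-idea-43 g5 for a port hand) of §3g `…Cruxes.NNDivisionHard.VirtualPassenger.MaxCutLP43` of the
registered LINE `Cruxes/NNDivisionHard/Lines/virtual_passenger.lean` rev 18 @21a5fb60d209 (pen val-idea-42 g2), lines 977–1784 — statements and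
proofs VERBATIM (author of the block: val-idea-43 g2/g3, card `maxcut-relaxation`, kernel `MaxCutLPSketch.lean` rev 3.3; pen intakes rev 9 / 13 / 15);
edits: namespace `…Theorems.FifoMatching.MaxCutLP`, `T` a local abbrev δ-equal to `XcDivision.T`, 30 helper docstrings, split in four parts for
the 400-line cap.  Purpose: free ≈ 46 KB of the line's 200 KB workfile budget (pen's BYTES NOTE 2026-08-28T23:26:44Z); after landing the line
replaces §3g by `import` + `open …MaxCutLP` (names unchanged below the namespace).
-/

set_option linter.dupNamespace false

namespace Summit.ValiantsHypothesis.ValiantsHypothesis.Theorems.FifoMatching.MaxCutLP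

open Matrix Finset
open scoped Pointwise
open Literature.Barriers.PneNP (HasEFOfSize)
open Literature.Combinatorics.Optimization (corPolytopeGraph corVec)

variable {h : ℕ}

section Unconditional

open Literature.Combinatorics.Optimization (CSPInstance CSPConstraint maxCutPreds
  KothariMekaRaghavendra2017_cor15_maxCut_holds)
open Literature.Barriers.PneNP (ExtendedFormulation)
open Filter Topology

/-! ### §6d hypothesis-free consequences: `MaxCutLPApproxHard`, `MaxCutLPHard`, classes K and K_θ DECIDED -/

/-- ★★★ `MaxCutLPApproxHard` HOLDS (the statement of the line's KNOWN stub `stub_maxCutLPApproxHard`). -/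
theorem maxCutLPApproxHard_holds : MaxCutLPApproxHard :=
  maxCutLPApproxHard_of_kmr KMR.maxCutLPGapHard_holds

/-- ★★★ `MaxCutLPHard` HOLDS. -/
theorem maxCutLPHard_holds : MaxCutLPHard :=
  maxCutLPHard_of_kmr KMR.maxCutLPGapHard_holds


/-! ### §6e–§6f (rev 15 intake of val-idea-43 g3's `MaxCutLPSketch.lean` REV 3.3 @e1aa7abe61e8 §6e + the head of §6f, statements and proofs
VERBATIM minus `zFull_decided` (needs §4) and minus the move-stability block `affApprox_nfBody` … `cutDominant_nf_decided` (cited in the honesty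
clause, not load-bearing); crit-9 g1 KERNEL-FOOD LIST item (iii)). ⟨abr.⟩ -/


/-- **CLASS K_θ^hull**: some point of the hull is, for every nonnegative instance, within `θ·maxcut(w)` of the family's maximum. -/
def GapThinHull (θ : ℝ) (h : ℕ) {J : Type} (q : J → (Fin h × Fin h → ℝ)) : Prop :=
  ∃ q₀ ∈ convexHull ℝ (Set.range q),
    ∀ w : Fin h × Fin h → ℝ, (∀ p, 0 ≤ w p) → ∀ j' : J, lapVal w (q j') ≤ lapVal w q₀ + θ * maxCut w

/-- gap-thinness passes from the point family to its convex hull. -/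
theorem gapThinHull_of_gapThin {θ : ℝ} {J : Type} {q : J → (Fin h × Fin h → ℝ)} (hK : GapThin θ h q) :
    GapThinHull θ h q := by
  obtain ⟨j₀, hj₀⟩ := hK
  exact ⟨q j₀, subset_convexHull ℝ _ ⟨j₀, rfl⟩, hj₀⟩

/-- the translation lemma, hull form and arbitrary index type. -/
theorem isMaxCutApprox_translate_hull {θ : ℝ} {J : Type} {q : J → (Fin h × Fin h → ℝ)} {q₀ : Fin h × Fin h → ℝ}
    (hq₀ : q₀ ∈ convexHull ℝ (Set.range q))
    (hj₀ : ∀ w : Fin h × Fin h → ℝ, (∀ p, 0 ≤ w p) → ∀ j', lapVal w (q j') ≤ lapVal w q₀ + θ * maxCut w) :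
    IsMaxCutApprox θ ((fun x => x + -q₀) ''
      (corPolytopeGraph (⊤ : SimpleGraph (Fin h)) + convexHull ℝ (Set.range q))) := by
  constructor
  · intro x hx
    refine ⟨x + q₀, ?_, by simp⟩
    exact Set.add_mem_add hx hq₀
  · rintro w hw _ ⟨y, hy, rfl⟩
    obtain ⟨p, hp, z, hz, rfl⟩ := Set.mem_add.1 hy
    have hpz : lapVal w (p + z + -q₀) = lapVal w p + (lapVal w z - lapVal w q₀) := by
      rw [lapVal_add, lapVal_add, lapVal_neg]; ring
    have h1 : lapVal w p ≤ maxCut w := lapVal_le_maxCut_of_mem_cor w p hp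
    have h2 : lapVal w z ≤ lapVal w q₀ + θ * maxCut w := by
      refine lapVal_le_of_mem_convexHull w (Set.range q) _ ?_ z hz
      rintro _ ⟨j', rfl⟩
      exact hj₀ w hw j'
    rw [hpz]
    linarith

/-- ★★★ **CLASS K_θ^hull IS DECIDED (unconditionally, every `θ < 1`, every index type)**. -/
theorem gapThinHull_decided_holds (θ : ℝ) (hθ : θ < 1) :
    ∀ c : ℕ, ∃ h₀ : ℕ, ∀ h ≥ h₀, ∀ (J : Type) (q : J → (Fin h × Fin h → ℝ)) (r : ℕ),
      GapThinHull θ h q →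
      HasEFOfSize (corPolytopeGraph (⊤ : SimpleGraph (Fin h)) + convexHull ℝ (Set.range q)) r → T c h < r := by
  intro c
  obtain ⟨h₀, hh₀⟩ := maxCutLPApproxHard_holds θ hθ c
  refine ⟨h₀, fun h hh J q r hK hEF => ?_⟩
  obtain ⟨q₀, hq₀, hj₀⟩ := hK
  exact hh₀ h hh _ r (isMaxCutApprox_translate_hull hq₀ hj₀) (hEF.image_add_const (-q₀))

/-- ★★★ **CLASS K IS DECIDED for every index type** (e.g. `Z_full` presented by its `Finset`-indexed spanning points). -/
theorem cutDominant_decided_holds' :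
    ∀ c : ℕ, ∃ h₀ : ℕ, ∀ h ≥ h₀, ∀ (J : Type) (q : J → (Fin h × Fin h → ℝ)) (r : ℕ),
      CutDominant h q →
      HasEFOfSize (corPolytopeGraph (⊤ : SimpleGraph (Fin h)) + convexHull ℝ (Set.range q)) r → T c h < r := by
  intro c
  obtain ⟨h₀, hh₀⟩ := gapThinHull_decided_holds 0 (by norm_num) c
  exact ⟨h₀, fun h hh J q r hK hEF => hh₀ h hh J q r (gapThinHull_of_gapThin (gapThin_zero_of_cutDominant hK)) hEF⟩


/-- **CLASS K_θ^aff (body level, explicit scale `s` and shift `v`)**: `s·R + v` is a `(1+θ)`-approximate MAX-CUT LP relaxation. -/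
def AffApprox (θ s : ℝ) (v : Fin h × Fin h → ℝ) (R : Set (Fin h × Fin h → ℝ)) : Prop :=
  IsMaxCutApprox θ ((fun y => s • y + v) '' R)

/-- constant cuts have value `0` (line currency). -/
theorem cutVal_const (w : Fin h × Fin h → ℝ) (c : Bool) : cutVal w (fun _ => c) = 0 := by
  unfold cutVal lapVal
  refine Finset.sum_eq_zero fun i _ => Finset.sum_eq_zero fun j _ => ?_
  by_cases hij : i = j
  · simp [wOff, hij]
  · rw [cutDirG_dot_corVec i j hij]; simp

/-- the max-cut value is nonnegative (line currency). -/
theorem maxCut_nonneg (w : Fin h × Fin h → ℝ) : 0 ≤ maxCut w := by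
  have := cutVal_le_maxCut w (fun _ => false); rwa [cutVal_const] at this

/-- monotonicity of `IsMaxCutApprox` in the tolerance. -/
theorem IsMaxCutApprox.mono {θ θ' : ℝ} (hθ : θ ≤ θ') {R : Set (Fin h × Fin h → ℝ)} (hR : IsMaxCutApprox θ R) :
    IsMaxCutApprox θ' R :=
  ⟨hR.1, fun w hw y hy => (hR.2 w hw y hy).trans (mul_le_mul_of_nonneg_right (by linarith) (maxCut_nonneg w))⟩

/-- monotonicity of `AffApprox` in the tolerance. -/
theorem AffApprox.mono {θ θ' s : ℝ} (hθ : θ ≤ θ') {v : Fin h × Fin h → ℝ} {R : Set (Fin h × Fin h → ℝ)}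
    (hR : AffApprox θ s v R) : AffApprox θ' s v R :=
  IsMaxCutApprox.mono hθ hR

/-- an EF of `R` gives an EF of the affine image `s • R + {v}` of the same size. -/
theorem hasEFOfSize_affineImage {R : Set (Fin h × Fin h → ℝ)} {r : ℕ} (hR : HasEFOfSize R r) (s : ℝ)
    (v : Fin h × Fin h → ℝ) : HasEFOfSize ((fun y => s • y + v) '' R) r := by
  have := hR.image_affine (s • (LinearMap.id : (Fin h × Fin h → ℝ) →ₗ[ℝ] (Fin h × Fin h → ℝ))) v
  simpa only [LinearMap.smul_apply, LinearMap.id_coe, id_eq] using this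

/-- ★ **CLASS K_θ^aff IS DECIDED (unconditionally, every `θ < 1`, any scale and shift).** -/
theorem affApprox_decided_holds (θ : ℝ) (hθ : θ < 1) :
    ∀ c : ℕ, ∃ h₀ : ℕ, ∀ h ≥ h₀, ∀ (R : Set (Fin h × Fin h → ℝ)) (s : ℝ) (v : Fin h × Fin h → ℝ) (r : ℕ),
      AffApprox θ s v R → HasEFOfSize R r → T c h < r := by
  intro c
  obtain ⟨h₀, hh₀⟩ := maxCutLPApproxHard_holds θ hθ c
  exact ⟨h₀, fun h hh R s v r hA hEF => hh₀ h hh _ r hA (hasEFOfSize_affineImage hEF s v)⟩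

/-- a gap-thin hull is an affine max-cut approximation. -/
theorem affApprox_of_gapThinHull {θ : ℝ} {J : Type} {q : J → (Fin h × Fin h → ℝ)} (hK : GapThinHull θ h q) :
    ∃ v, AffApprox θ 1 v (corPolytopeGraph (⊤ : SimpleGraph (Fin h)) + convexHull ℝ (Set.range q)) := by
  obtain ⟨q₀, hq₀, hj₀⟩ := hK
  refine ⟨-q₀, ?_⟩
  have := isMaxCutApprox_translate_hull hq₀ hj₀
  unfold AffApprox
  simpa only [one_smul] using this


/-- **CLASS K^aff_θ — AFFINELY GAP-THIN families (rev 15, family level of 43 g3's `AffApprox`)**: after some scaling `s` and shift `v` the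
PAIR BODY `COR(K_h) + conv q` is a `(1+θ)`-approximate MAX-CUT LP relaxation.  ⊇ K_θ^hull ⊇ K_θ ⊇ K (`affThin_of_gapThinHull`,
`gapThinHull_of_gapThin`, `gapThin_zero_of_cutDominant`); tolerant, value-level, presentation-free, move-stable (43 §6f). -/
def AffThin (θ : ℝ) (h : ℕ) {J : Type} (q : J → (Fin h × Fin h → ℝ)) : Prop :=
  ∃ (s : ℝ) (v : Fin h × Fin h → ℝ), AffApprox θ s v (corPolytopeGraph (⊤ : SimpleGraph (Fin h)) + convexHull ℝ (Set.range q))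

/-- `GapThinHull θ ⇒ AffThin θ`. -/
theorem affThin_of_gapThinHull {θ : ℝ} {J : Type} {q : J → (Fin h × Fin h → ℝ)} (hK : GapThinHull θ h q) : AffThin θ h q := by
  obtain ⟨v, hv⟩ := affApprox_of_gapThinHull hK
  exact ⟨1, v, hv⟩

/-- `GapThin θ ⇒ AffThin θ`. -/
theorem affThin_of_gapThin {θ : ℝ} {J : Type} {q : J → (Fin h × Fin h → ℝ)} (hK : GapThin θ h q) : AffThin θ h q :=
  affThin_of_gapThinHull (gapThinHull_of_gapThin hK)

/-- `CutDominant ⇒ AffThin θ` for every `θ ≥ 0` (via gap-thinness at tolerance `0`). -/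
theorem affThin_of_cutDominant {J : Type} {q : J → (Fin h × Fin h → ℝ)} (hK : CutDominant h q) (θ : ℝ) (hθ : 0 ≤ θ) :
    AffThin θ h q := by
  obtain ⟨s, v, hv⟩ := affThin_of_gapThin (gapThin_zero_of_cutDominant hK)
  exact ⟨s, v, hv.mono hθ⟩

/-- ★★★ **CLASS K^aff_θ IS DECIDED (unconditionally, every `θ < 1`, every index type)** — TREE theorems only (KMR via §6). -/
theorem affThin_decided_holds (θ : ℝ) (hθ : θ < 1) :
    ∀ c : ℕ, ∃ h₀ : ℕ, ∀ h ≥ h₀, ∀ (J : Type) (q : J → (Fin h × Fin h → ℝ)) (r : ℕ),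
      AffThin θ h q →
      HasEFOfSize (corPolytopeGraph (⊤ : SimpleGraph (Fin h)) + convexHull ℝ (Set.range q)) r → T c h < r := by
  intro c
  obtain ⟨h₀, hh₀⟩ := affApprox_decided_holds θ hθ c
  refine ⟨h₀, fun h hh J q r hK hEF => ?_⟩
  obtain ⟨s, v, hv⟩ := hK
  exact hh₀ h hh _ s v r hv hEF

end Unconditional

end Summit.ValiantsHypothesis.ValiantsHypothesis.Theorems.FifoMatching.MaxCutLP
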